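import Mathlib
import Literature.AlgebraicGeometry.Resolution.CobordantGame
import Literature.AlgebraicGeometry.Resolution.FormalCoordinateChange
import Summits.ResolutionOfSingularities.ResolutionOfSingularities.Theorems.WeightedInvariantLocalWeightedDropConeDichotomy
import Summits.ResolutionOfSingularities.ResolutionOfSingularities.Theorems.WeightedInvariantLocalWeightedDropWeierstrassForm

/-!
# `WeightedInvariant.LocalWeightedDrop`, line `hasse-ridge-face-selection`: the dichotomy for a singular monic double-point
# slice — hyperbolic exit or re-normalisation to a new position

Crux item stmt-ResolutionOfSingularities-8899 `LocalWeightedDrop` (route `ResolutionOfSingularities/WeightedInvariant`),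
serving the door `WeightedConstruction` stmt-ResolutionOfSingularities-0571.  [OURS · L1 W4.3, chain w43, stub worker 3:
packaging for the N4 author of CRUX-PLAN w43 §3C (the `good` obligation of `monicDoublePointsWon_of_rank`).  Not a statement of
any manuscript.]

* `order_monicTwo_of_isSingular`: a singular slice `y² + Σ_{j<2} B_j y^j` (the shape produced by the bricks
  `won_monic_of_pointBlowup` / `won_monic_of_curveBlowup` at `d = 2`) has order exactly `2`.
* `monicSlice_dichotomy` (`k` algebraically closed, any characteristic, `n + 3` variables): a singular germ of order `2` EITHER
  carries the hyperbolic-quadric witness of `TangentConeCut.hyperbolicStartsWon` (exit), OR re-normalises: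
  `S ∘ M = H · (y² + A₀' + A₁' y)` with `M` invertible, `H(0) ≠ 0`, `ord A₀' ≥ 3`, `ord A₁' ≥ 2` (a new position of the wild
  coefficient game) — `stub_coneDichotomy` + `UnaryConeForm.normalForm_of_sq` + `WeierstrassForm.monicForm_two`.
So the rank player of N4 only has to prove `κ(A₀', A₁') < κ(A₀, A₁)` in the second case (for an intrinsic `κ`), or to supply a
re-normalisation of its own.
-/

set_option linter.dupNamespace false -- mandated namespace of this single-conjunct summit

namespace Summit.ResolutionOfSingularities.ResolutionOfSingularities.Theorems

open Literature.AlgebraicGeometry.Resolution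
open Literature.AlgebraicGeometry.Resolution.CobordantGame

open MvPowerSeries in
/-- A SINGULAR monic double point `y² + Σ_{j<2} B_j(x') y^j` has order exactly `2` (its `y²`-coefficient is `1`). -/
theorem order_monicTwo_of_isSingular {k : Type} [Field k] {m : ℕ} (B : Fin 2 → MvPowerSeries (Fin m) k)
    (hS : CobordantGame.IsSingular k (MvPowerSeries.X (Fin.last m) ^ 2 +
      ∑ j : Fin 2, MvPowerSeries.rename (Fin.succAboveEmb (Fin.last m)) (B j) * MvPowerSeries.X (Fin.last m) ^ (j : ℕ))) :
    (MvPowerSeries.X (Fin.last m) ^ 2 +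
      ∑ j : Fin 2, MvPowerSeries.rename (Fin.succAboveEmb (Fin.last m)) (B j) * MvPowerSeries.X (Fin.last m) ^ (j : ℕ)).order = 2 := by
  classical
  refine le_antisymm ?_ ((FormalCoordChange.two_le_order_iff _).mpr hS.2)
  have hc : coeff (Finsupp.single (Fin.last m) 2) (X (Fin.last m) ^ 2 +
      ∑ j : Fin 2, rename (Fin.succAboveEmb (Fin.last m)) (B j) * X (Fin.last m) ^ (j : ℕ)) = 1 := by
    have h0 : Finsupp.single (Fin.last m) 2 =
        Finsupp.embDomain (Fin.succAboveEmb (Fin.last m)) (0 : Fin m →₀ ℕ) + Finsupp.single (Fin.last m) 2 := by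
      rw [Finsupp.embDomain_zero, zero_add]
    rw [h0, WeierstrassForm.coeff_monicForm, if_pos rfl, coeff_zero_eq_constantCoeff_apply, map_one,
      Finset.sum_eq_zero (fun j _ => if_neg (by have := j.2; omega)), add_zero]
  have h := order_le (f := X (Fin.last m) ^ 2 +
      ∑ j : Fin 2, rename (Fin.succAboveEmb (Fin.last m)) (B j) * X (Fin.last m) ^ (j : ℕ))
    (d := Finsupp.single (Fin.last m) 2) (by rw [hc]; exact one_ne_zero)
  rw [Finsupp.degree_single] at h
  exact_mod_cast h

open MvPowerSeries in
/-- THE DICHOTOMY FOR A SINGULAR GERM OF ORDER `2` (`k` algebraically closed): hyperbolic-quadric witness, OR re-normalisation to a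
monic double point `S ∘ M = H · (y² + A₀' + A₁' y)` with `ord A₀' ≥ 3`, `ord A₁' ≥ 2`. -/
theorem monicSlice_dichotomy (k : Type) [Field k] [IsAlgClosed k] {n : ℕ} (S : MvPowerSeries (Fin (n + 3)) k)
    (hS : CobordantGame.IsSingular k S) (h2 : S.order = 2) :
    (∃ θ : Fin (n + 3) → MvPowerSeries (Fin (n + 3)) k, (∀ i, MvPowerSeries.constantCoeff (θ i) = 0) ∧
        IsUnit (Matrix.det (Matrix.of fun i j => MvPowerSeries.coeff (Finsupp.single j 1) (θ i))) ∧
        MvPowerSeries.coeff (Finsupp.single 0 2) (MvPowerSeries.subst θ S) = 0 ∧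
        MvPowerSeries.coeff (Finsupp.single 1 2) (MvPowerSeries.subst θ S) = 0 ∧
        MvPowerSeries.coeff (Finsupp.single 0 1 + Finsupp.single 1 1) (MvPowerSeries.subst θ S) ≠ 0) ∨
      (∃ (M : Matrix (Fin (n + 3)) (Fin (n + 3)) k) (H : MvPowerSeries (Fin (n + 3)) k)
          (A₀' A₁' : MvPowerSeries (Fin (n + 2)) k),
        IsUnit M.det ∧ MvPowerSeries.constantCoeff H ≠ 0 ∧ (2 : ℕ∞) < A₀'.order ∧ (1 : ℕ∞) < A₁'.order ∧
        MvPowerSeries.subst (FormalCoordChange.linSubst M) S =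
          H * (MvPowerSeries.X (Fin.last (n + 2)) ^ 2 +
            (MvPowerSeries.rename (Fin.succAboveEmb (Fin.last (n + 2))) A₀' +
              MvPowerSeries.rename (Fin.succAboveEmb (Fin.last (n + 2))) A₁' * MvPowerSeries.X (Fin.last (n + 2))))) := by
  rcases stub_coneDichotomy k (n + 1) S hS with hhyp | ⟨ℓ, hℓ⟩
  · exact Or.inl hhyp
  · right
    obtain ⟨M, U, a₀, a₁, hMdet, hU, ha₀, ha₁, hSeq⟩ := UnaryConeForm.normalForm_of_sq S h2 ℓ hℓ
    obtain ⟨H, A₀, A₁, hH, hA₀, hA₁, heq⟩ :=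
      WeierstrassForm.monicForm_two (U := U) (by rw [hU]; exact one_ne_zero) a₀ a₁ ha₀ ha₁
    exact ⟨M, H, A₀, A₁, hMdet, hH, hA₀, hA₁, by rw [hSeq, heq]⟩

end Summit.ResolutionOfSingularities.ResolutionOfSingularities.Theorems
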